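import Summits.SmoothPoincare4.SmoothPoincare4.Theorems.SymplecticOrigamiOrigamiFoldExistenceShadowPleatsDefs
import Summits.SmoothPoincare4.SmoothPoincare4.Theorems.SymplecticOrigamiOrigamiFoldExistenceStubPleatFreeStandardShadow

/-!
# CLEAN pleats — vocabulary addendum of the line `shadow-pleats` for crux `OrigamiFoldExistence`
(item stmt-SmoothPoincare4-7844, route route-SmoothPoincare4-SymplecticOrigami; line lead seat 1, reshape r3)

Wave 1 of the line returned `stub-misstated` for BOTH low rungs as typed over arbitrary pleats
(S5 `stub_onePleatIroning`, S4 `stub_twoPleatUnthreading`): for a WILD pleat (hole or annulus with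
self-overlapping, merely immersed shadow) there is neither an argument nor a counterexample, and any
height-blind argument is SPC4-hard (Disproof.lean §7c (α)); for CLEAN pleats the rungs are theorems
on paper (Disproof §7c (γ)/(γ') re-derived with two repairs by the S5 worker; a fibrewise degree count
by the S4 worker shows that a position all of whose charts are clean is already standard).  The
reshaped skeleton (lead r3) therefore types the ladder over CLEAN positions, and this file lands the
two predicates it needs, once, next to the line's `…ShadowPleatsDefs`:

* `IsCleanPleat ι e` — Disproof §7c (γ) made primitive (S5 worker): the chart shadow
  `G = proj5 ∘ ι ∘ e` is injective on the closed HOLE `{|u| ≤ 1}`, on the closed ANNULUS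
  `{1 ≤ |u| ≤ 2}` and on a closed COLLAR `{2 ≤ |u| ≤ 2 + ε}` separately, with the radial-model
  NESTING of their images;
* `HasCleanPleatedPosition M k` — a pleated round-rim position with `k` charts all clean (S4 worker),
  with the bookkeeping `HasCleanPleatedPosition.hasPleatedPosition`, `hasCleanPleatedPosition_zero_iff`
  (no charts: cleanness vacuous), `hasCleanPleatedPosition_one_iff`;
* NON-VACUITY (sorry-free, S5 worker): the radial zig-zag (`Z`-profile) shadow `CleanModel.G`
  satisfies all five clauses with `ε = 1/2` — `isCleanPleat_zigzagModel` (registered certificate;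
  `M = ℝ⁴`, `e = id`, `ι = embedL ∘ G`, only the shadow matters).

Deliberately NOT here: the reshaped stub statements (they live in the skeleton
`Cruxes/OrigamiFoldExistence/Lines/shadow_pleats.lean` and in the stub files), and the workers'
paper lemmas (`OuterSheetEmbedded`, `StraightenOfOuterSheetEmbedded`, the deletion lemma), which
are CLAIMS of the line, registered as stubs, not definitions.
-/

noncomputable section

-- the prescribed namespace `Summit.<P>.<Sub>.…` duplicates `SmoothPoincare4` (P = Sub)
set_option linter.dupNamespace false

open scoped Manifold ContDiff Topology
open Set Function Metric

namespace Summit.SmoothPoincare4.SmoothPoincare4.Theorems.OrigamiFoldExistence.ShadowPleats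

/-! ### The cleanness predicate (S5 worker, Disproof §7c (γ) made primitive) -/

/-- A pleat chart `e : ℝ⁴ → M` of an embedding `ι : M → ℝ⁵` is CLEAN (Disproof.lean §7c (γ),
made primitive): writing `G = proj5 ∘ ι ∘ e` for the shadow in the chart, for some `ε > 0`
* `G` is injective on the closed HOLE `{|u| ≤ 1}`, on the closed ANNULUS `{1 ≤ |u| ≤ 2}` and on
  the closed COLLAR `{2 ≤ |u| ≤ 2 + ε}` (three sheets, each embedded by the shadow — NOT their
  union: the collar folds back over the annulus, the annulus over the hole);
* NESTING as in the radial `Z`-profile model: the shadows of the annulus-minus-inner-fold-sphere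
  and of the collar lie in the shadow of the OPEN hole (so the outer crease `G {|u| = 2}` lies
  inside the inner crease `G {|u| = 1}`), and the shadow of the collar-minus-outer-fold-sphere lies
  in the shadow of the OPEN annulus (the collar leaves the outer crease on the annulus side).
Given `IsPleatedPosition`, the last three clauses follow on paper from the first two (fold normal
form + connectedness), and the first from the second (covering argument); they are kept so that the
deletion construction can use them without a Jordan–Brouwer theorem in `ℝ⁴`. -/
def IsCleanPleat {M : Type} (ι : M → EuclideanSpace ℝ (Fin 5)) (e : EuclideanSpace ℝ (Fin 4) → M) :
    Prop :=
  ∃ ε : ℝ, 0 < ε ∧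
    Set.InjOn (proj5 ∘ ι ∘ e) (Metric.closedBall 0 1) ∧
    Set.InjOn (proj5 ∘ ι ∘ e) (Metric.closedBall 0 2 \ Metric.ball 0 1) ∧
    Set.InjOn (proj5 ∘ ι ∘ e) (Metric.closedBall 0 (2 + ε) \ Metric.ball 0 2) ∧
    (proj5 ∘ ι ∘ e) '' (Metric.closedBall 0 (2 + ε) \ Metric.closedBall 0 1) ⊆
      (proj5 ∘ ι ∘ e) '' Metric.ball 0 1 ∧
    (proj5 ∘ ι ∘ e) '' (Metric.closedBall 0 (2 + ε) \ Metric.closedBall 0 2) ⊆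
      (proj5 ∘ ι ∘ e) '' (Metric.ball 0 2 \ Metric.closedBall 0 1)

/-! ### Clean pleated positions (S4 worker) -/

/-- `M` admits a pleated round-rim shadow position with `k` pleat charts ALL OF WHICH ARE CLEAN.
For `k = 0` this is `HasPleatedPosition M 0` (no charts); for `k = 1` it is the hypothesis of the
S5 worker's corrected `stub_onePleatIroning` (`∀ j : Fin 1` versus `e 0`, see
`hasCleanPleatedPosition_one_iff`).  Only clauses 1–2 of `IsCleanPleat` (shadow injective on the
closed hole and on the closed annulus) are consumed by the recognition theorem below; given
`IsPleatedPosition`, clauses 3–5 follow from clause 2 on paper (S5 worker's remark (2)). -/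
def HasCleanPleatedPosition (M : Type) [TopologicalSpace M]
    [ChartedSpace (EuclideanSpace ℝ (Fin 4)) M] (k : ℕ) : Prop :=
  ∃ (ι : M → EuclideanSpace ℝ (Fin 5)) (δ : ℝ) (e : Fin k → EuclideanSpace ℝ (Fin 4) → M),
    IsPleatedPosition ι δ e ∧ ∀ j, IsCleanPleat ι (e j)

/-- A clean position is in particular a position. [folklore] -/
theorem HasCleanPleatedPosition.hasPleatedPosition {M : Type} [TopologicalSpace M]
    [ChartedSpace (EuclideanSpace ℝ (Fin 4)) M] {k : ℕ} (h : HasCleanPleatedPosition M k) :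
    HasPleatedPosition M k := by
  obtain ⟨ι, δ, e, hι, -⟩ := h
  exact ⟨ι, δ, e, hι⟩

/-- With no charts, cleanness is vacuous: `HasCleanPleatedPosition M 0 ↔ HasPleatedPosition M 0`.
[folklore] -/
theorem hasCleanPleatedPosition_zero_iff (M : Type) [TopologicalSpace M]
    [ChartedSpace (EuclideanSpace ℝ (Fin 4)) M] :
    HasCleanPleatedPosition M 0 ↔ HasPleatedPosition M 0 := by
  refine ⟨HasCleanPleatedPosition.hasPleatedPosition, fun ⟨ι, δ, e, hι⟩ => ?_⟩
  exact ⟨ι, δ, e, hι, fun j => Fin.elim0 j⟩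

/-- With one chart, `∀ j, IsCleanPleat ι (e j)` is `IsCleanPleat ι (e 0)` (the S5 worker's form).
[folklore] -/
theorem hasCleanPleatedPosition_one_iff (M : Type) [TopologicalSpace M]
    [ChartedSpace (EuclideanSpace ℝ (Fin 4)) M] :
    HasCleanPleatedPosition M 1 ↔
      ∃ (ι : M → EuclideanSpace ℝ (Fin 5)) (δ : ℝ) (e : Fin 1 → EuclideanSpace ℝ (Fin 4) → M),
        IsPleatedPosition ι δ e ∧ IsCleanPleat ι (e 0) := by
  constructor
  · rintro ⟨ι, δ, e, hι, hc⟩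
    exact ⟨ι, δ, e, hι, hc 0⟩
  · rintro ⟨ι, δ, e, hι, hc⟩
    refine ⟨ι, δ, e, hι, fun j => ?_⟩
    rwa [Fin.fin_one_eq_zero j]

/-! ### Non-vacuity of `IsCleanPleat`: the radial zig-zag (`Z`-profile) shadow satisfies all
five clauses (hole = identity, annulus folded back to radii `[1/2, 1]`, collar folded out again),
with `ε = 1/2`.  Only the SHADOW matters for `IsCleanPleat`, so the certificate takes `M = ℝ⁴`,
`e = id` and `ι u = (G u, 0)`. -/

namespace CleanModel

/-- The zig-zag radial profile: `r` on `[0,1]`, `(3 - r)/2` on `[1,2]`, `(r - 1)/2` on `[2, ∞)`. -/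
def zig (r : ℝ) : ℝ := if r ≤ 1 then r else 1 / 2 + |r - 2| / 2

/-- On `[0,1]` the profile is the identity. -/
theorem zig_of_le_one {r : ℝ} (h : r ≤ 1) : zig r = r := by simp [zig, h]

/-- On `[1,2]` the profile decreases from `1` to `1/2`. -/
theorem zig_of_mem_Icc {r : ℝ} (h1 : 1 ≤ r) (h2 : r ≤ 2) : zig r = (3 - r) / 2 := by
  by_cases h : r ≤ 1
  · have hr : r = 1 := le_antisymm h h1
    subst hr
    norm_num [zig]
  · rw [zig, if_neg h, abs_of_nonpos (by linarith)]
    ring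

/-- On `[2, ∞)` the profile increases from `1/2`. -/
theorem zig_of_two_le {r : ℝ} (h : 2 ≤ r) : zig r = (r - 1) / 2 := by
  rw [zig, if_neg (by linarith), abs_of_nonneg (by linarith)]
  ring

/-- The profile is positive on `(0, ∞)`. -/
theorem zig_pos {r : ℝ} (h : 0 < r) : 0 < zig r := by
  by_cases h1 : r ≤ 1
  · rwa [zig_of_le_one h1]
  · rw [zig, if_neg h1]
    positivity

/-- The profile is non-negative on `[0, ∞)`. -/
theorem zig_nonneg {r : ℝ} (h : 0 ≤ r) : 0 ≤ zig r := by
  rcases h.eq_or_lt with h0 | h0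
  · subst h0
    simp [zig]
  · exact (zig_pos h0).le

/-- The radial zig-zag map `u ↦ zig |u| · u/|u|` (the shadow of the model `Z`-profile pleat). -/
def G (u : EuclideanSpace ℝ (Fin 4)) : EuclideanSpace ℝ (Fin 4) := (zig ‖u‖ / ‖u‖) • u

/-- `|G u| = zig |u|`. -/
theorem norm_G (u : EuclideanSpace ℝ (Fin 4)) : ‖G u‖ = zig ‖u‖ := by
  by_cases h0 : u = 0
  · subst h0
    simp [G, zig]
  · have hn : ‖u‖ ≠ 0 := norm_ne_zero_iff.mpr h0
    rw [G, norm_smul, Real.norm_eq_abs,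
      abs_of_nonneg (div_nonneg (zig_nonneg (norm_nonneg _)) (norm_nonneg _)),
      div_mul_cancel₀ _ hn]

/-- On the closed unit ball `G` is the identity. -/
theorem G_of_norm_le_one {u : EuclideanSpace ℝ (Fin 4)} (h : ‖u‖ ≤ 1) : G u = u := by
  by_cases h0 : u = 0
  · subst h0
    simp [G]
  · have hn : ‖u‖ ≠ 0 := norm_ne_zero_iff.mpr h0
    rw [G, zig_of_le_one h, div_self hn, one_smul]

/-- Two non-zero points with the same norm and the same image coincide. -/
theorem eq_of_G_eq {u v : EuclideanSpace ℝ (Fin 4)} (hn : ‖u‖ = ‖v‖) (hpos : 0 < ‖u‖)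
    (h : G u = G v) : u = v := by
  have hc : zig ‖u‖ / ‖u‖ ≠ 0 := div_ne_zero (zig_pos hpos).ne' hpos.ne'
  rw [G, G, ← hn] at h
  exact smul_right_injective _ hc h

/-- Clause 1: the hole is embedded. -/
theorem injOn_G_hole : Set.InjOn G (Metric.closedBall 0 1) := by
  intro u hu v hv h
  rw [mem_closedBall_zero_iff] at hu hv
  rwa [G_of_norm_le_one hu, G_of_norm_le_one hv] at h

/-- Clause 2: the annulus is embedded. -/
theorem injOn_G_annulus : Set.InjOn G (Metric.closedBall 0 2 \ Metric.ball 0 1) := by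
  rintro u ⟨hu2, hu1⟩ v ⟨hv2, hv1⟩ h
  rw [mem_closedBall_zero_iff] at hu2 hv2
  rw [mem_ball_zero_iff, not_lt] at hu1 hv1
  have hnorm : ‖G u‖ = ‖G v‖ := by rw [h]
  rw [norm_G, norm_G, zig_of_mem_Icc hu1 hu2, zig_of_mem_Icc hv1 hv2] at hnorm
  exact eq_of_G_eq (by linarith) (by linarith) h

/-- Clause 3: the collar is embedded. -/
theorem injOn_G_collar : Set.InjOn G (Metric.closedBall 0 (2 + 1 / 2) \ Metric.ball 0 2) := by
  rintro u ⟨-, hu1⟩ v ⟨-, hv1⟩ h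
  rw [mem_ball_zero_iff, not_lt] at hu1 hv1
  have hnorm : ‖G u‖ = ‖G v‖ := by rw [h]
  rw [norm_G, norm_G, zig_of_two_le hu1, zig_of_two_le hv1] at hnorm
  exact eq_of_G_eq (by linarith) (by linarith) h

/-- Clause 4: annulus-minus-inner-sphere and collar map into the shadow of the open hole. -/
theorem image_G_subset_hole :
    G '' (Metric.closedBall 0 (2 + 1 / 2) \ Metric.closedBall 0 1) ⊆ G '' Metric.ball 0 1 := by
  rintro x ⟨u, ⟨hu2, hu1⟩, rfl⟩
  rw [mem_closedBall_zero_iff] at hu2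
  rw [mem_closedBall_zero_iff, not_le] at hu1
  have hlt : ‖G u‖ < 1 := by
    rw [norm_G]
    by_cases h2 : ‖u‖ ≤ 2
    · rw [zig_of_mem_Icc hu1.le h2]
      linarith
    · rw [zig_of_two_le (by linarith)]
      linarith
  exact ⟨G u, mem_ball_zero_iff.mpr hlt, G_of_norm_le_one hlt.le⟩

/-- Clause 5: the collar-minus-outer-sphere maps into the shadow of the open annulus (the point
`((4 - |u|)/|u|) u` of the open annulus has the same image as the collar point `u`). -/
theorem image_G_collar_subset_annulus :
    G '' (Metric.closedBall 0 (2 + 1 / 2) \ Metric.closedBall 0 2) ⊆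
      G '' (Metric.ball 0 2 \ Metric.closedBall 0 1) := by
  rintro x ⟨u, ⟨hu2, hu1⟩, rfl⟩
  rw [mem_closedBall_zero_iff] at hu2
  rw [mem_closedBall_zero_iff, not_le] at hu1
  have hn : ‖u‖ ≠ 0 := by linarith
  have h4 : 0 < 4 - ‖u‖ := by linarith
  have hv : ‖((4 - ‖u‖) / ‖u‖) • u‖ = 4 - ‖u‖ := by
    rw [norm_smul, Real.norm_eq_abs, abs_of_nonneg (div_nonneg h4.le (norm_nonneg _)),
      div_mul_cancel₀ _ hn]
  refine ⟨((4 - ‖u‖) / ‖u‖) • u, ⟨?_, ?_⟩, ?_⟩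
  · rw [mem_ball_zero_iff, hv]
    linarith
  · rw [mem_closedBall_zero_iff, hv, not_le]
    linarith
  · rw [G, G, hv, smul_smul, zig_of_mem_Icc (by linarith) (by linarith), zig_of_two_le hu1.le]
    congr 1
    field_simp
    ring

end CleanModel

/-- **`IsCleanPleat` is satisfiable** (registered certificate): the zig-zag shadow, with `M = ℝ⁴`,
`e = id`, `ι = embedL ∘ G` (height `0`; only the shadow matters), `ε = 1/2`. [folklore] -/
theorem isCleanPleat_zigzagModel :
    IsCleanPleat (fun u : EuclideanSpace ℝ (Fin 4) => embedL (CleanModel.G u)) id := by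
  have hG : proj5 ∘ (fun u : EuclideanSpace ℝ (Fin 4) => embedL (CleanModel.G u)) ∘ id =
      CleanModel.G := by
    funext u
    simp
  refine ⟨1 / 2, by norm_num, ?_, ?_, ?_, ?_, ?_⟩
  · rw [hG]; exact CleanModel.injOn_G_hole
  · rw [hG]; exact CleanModel.injOn_G_annulus
  · rw [hG]; exact CleanModel.injOn_G_collar
  · rw [hG]; exact CleanModel.image_G_subset_hole
  · rw [hG]; exact CleanModel.image_G_collar_subset_annulus

end Summit.SmoothPoincare4.SmoothPoincare4.Theorems.OrigamiFoldExistence.ShadowPleats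

end
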